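import Literature.MathematicalPhysics.QuantumFieldTheory.Balaban1983to89.B11Eq90V0GroupComposed

/-!
# `Balaban1983to89.B11Eq80Current` — T. Bałaban, *The variational problem and background fields in renormalization group method for lattice gauge theories*, Commun. Math. Phys. **102** (1985) 277–309 [Balaban1985Variational]: (78)–(80) p. 290, (84)–(89) pp. 290–291, (63) p. 287 — `V(A′)` OF (80) AND ITS FUNCTIONAL DERIVATIVE `W(A′) = (δ/δA′)V(A′)` AS ONE OBJECT ON THE CARRIERS OF (115), modulo the letters `J` (the current (27) of the background) and `Δ_π` ([5] (3.119)) at the carrier: the groups (85) `−𝔇₃*(A′)H*J`, (88) `−(Δ_π HD(A′) + 𝔇*(A′)H*Δ_π A′)`, (89) `𝔇*(A′)H*Δ_π HD(A′)` typed through the transposition of `B11Eq90Transpose`, summed with the composed V₀-group of `B11Eq90V0GroupComposed`, WITH THE (63) CERTIFICATE `⟨W(A′), δ⟩ = (d/dt)V(A′ + tδ)|_{t=0}` PROVED and analyticity on the ball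

statement-level skeleton of published theorems with citation tags; proofs where landed; nothing here is a claim about the Yang–Mills mass gap

PDF held: `paper:balaban1985-cmp102-variational-background` (journal page = PDF page + 276); pp. 285–293 read from the `lit read` text layer by
this seat (2026-08-21); displays as transcribed in `B11Eq81Expansion` ((80)–(81)), `B11Eq85FirstDerivative` ((85)–(90)), `B11Eq174Chart` ((47) as
`solA`), `B11Eq115Space` ((115)).

CITATION HEADER (lean-in-tree rule 2026-08-18).  WHAT IS REPRODUCED: rows `B11.Eq80`/`B11.Eq85`/`B11.Prop4` of r08's `ROWS-B11.md` — the function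
`V(A′)` of (80) and ALL FIVE groups W₁ … W₅ of `B11Prop4Assembly.TermwiseDatum` summed to `W = (δ/δA′)V` ((84)–(85)), as OBJECTS on the W-slot
carriers of pub-balaban NE9 letter (L3) (INTERFACE REQUEST NE9 (L3), HOME/INBOX.md l.13889: «`W := (δ/δA′)V` as an OBJECT `Space115 L η lev₀ lev₁
(nabla115 η U₀) → NegSize L η lev₀ 3 𝔸` … with `Prop4Hyp W C₄ a₃` DISPLAYED»; the W-slot of the owner's `NE9CurChartOfBackground.cur_chart_exists_of_W_H126`).
THE PRINT, verbatim.  p. 290 (78)–(80): *«Taking into account that the second order term D^{(2)}(A′) in the expansion of D(A′) is equal to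
C^{(2)}(A′) … we have ⟨HD(A′), J⟩ = ⟨HC^{(2)}(A′), J⟩ + ⟨HD₃(A′), J⟩. (78) Thus a quadratic form in the expansion of 𝒢(A′) is equal to …
= ½⟨A′, Δ₁A′⟩, (79) … Now let us write higher order terms. They determine the functional V(A′) = −⟨HD₃(A′), J⟩ − ⟨A′, Δ_π HD(A′)⟩ +
½⟨HD(A′), Δ_π HD(A′)⟩ + V₀(A′ − HD(A′)). (80) It is analytic in A′ …»*; (84) read with (99) p. 293: *«⟨δA′, J⟩ + ⟨δA′, Δ₁A′⟩ + ⟨δA′,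
(δ/δA′)V(A′)⟩ = 0. (99)»*; p. 291 (85), with
print's weights: *«−⟨H(δ/δA′)D₃(A′), J⟩ = −Σ_{b′}η^d Σ_{c₁∈𝔅_k}(L^{j₁}η)^d tr J(b′)H(b′, c₁)𝔇(A′; c₁, b)»* (schematically
`(δ/δA′(b))⟨HD₃(A′), J⟩ = Σ_{b′,c} 𝔇₃(A′; c, b)H(b′, c)J(b′)` — OUR READING, weights absorbed in the pairing); (87): *«⟨A′, Δ_π HD(A′)⟩ = ⟨A′, (Δ_π +
DRD*)HD(A′)⟩»* whose functional derivative print writes in (88) directly in the explicit form `Q*(QGQ*)⁻¹(Lʲ⁽·⁾η)⁻¹D(A′) − …` through the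
definition (45) of `H` — before that substitution it is `Δ_π HD(A′) + 𝔇*(A′)H*Δ_π A′` (OUR READING = `−W₂`); (89), verbatim: *«The functional
derivative of the third term in V(A′) is equal to 𝔇*(A′)H*Δ_π HD(A′)»*; p. 287 (63), verbatim: *«⟨(δ/δA′)D(A′), δA′⟩ = (d/dτ)D(A′ + τδA′)|_{τ=0}»*.

WHAT IS DEFINED AND PROVED (sorry-free; axioms `propext`/`Classical.choice`/`Quot.sound`; defs with bodies; no `Prop`-valued definition, no new
named fact; finite-dimensional fibre `𝔸 ⊇ 𝔤ᶜ`).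
§1 `Emap H C ε_C := −solA H 0 C 0 ε_C` (= `HD(A′) = A′ − A`, `Emap_eq_sub`; = `H(C(A))` under the Sect. C regime, `Emap_eq_H`); **`quadPart F Y :=
   ½·D²F(0)(Y, Y)`** (print's `C^{(2)}`/`D^{(2)}`, canonically via `iteratedFDeriv`; `contDiff_quadPart`, `analyticOnNhd_quadPart`); **`E3 := Emap −
   H ∘ quadPart C`** (= `HD₃`, (78)); `analyticOnNhd_Emap`, `analyticOnNhd_E3` on `ball 0 a_C`.
§2 `pairL τ : NegSize … 3 𝔸 →L[ℂ] Space115 … →L[ℂ] ℂ` — the pairing (27) as a continuous bilinear map (for the product rule).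
§3 **`V80 τ U₀ H C ε_C J Δπ : Space115 … → ℂ`** = (80) VERBATIM in the letters (`−⟨J, HD₃A′⟩ − ⟨Δπ(HD A′), A′⟩ + ½⟨Δπ(HD A′), HD A′⟩ +
   V₀(T A′)`, `V₀` = r08's `B11Eq26ActionExpansion.V0` under the torus bridge); **`W1`** = `−((HD₃)′(A′))ᵗ J` ((85)), **`W2`** = `−(Δπ(HD A′) +
   ((HD)′(A′))ᵗ(Δπ A′))` ((88)), **`W3`** = `((HD)′(A′))ᵗ(Δπ(HD A′))` ((89)), **`W80 := W1 + W2 + W3 + curV0full`** : `Space115 L η lev₀ lev₁ Dc →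
   NegSize L η lev₀ 3 𝔸` — THE W-SLOT TYPE, every operator letter an argument (`ρ, τ, U₀, H, C, ε_C, J, Δπ`).
§4 `hasDerivAt_line`, `hasDerivAt_comp_line`; **`pair27_W80`** — THE (63) CERTIFICATE: for `‖A′‖ < a_C` (Sect. C `Regime H 0 C b 0 C₂ c₄ 0 a_C ε_C`,
   `Prop4Hyp C C₂ c₄`), tracial `τ`, `τ(ρ(ℓ)X) = ℓ X`, `d ≥ 4`, and `Δπ` SYMMETRIC for the pairing (`⟨ΔπY, Z⟩ = ⟨ΔπZ, Y⟩`):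
   **`⟨W80(A′), δ⟩ = (d/dt) V80(A′ + tδ)|_{t=0}`** for every direction `δ` of the space (115) — so `W80` IS `(δ/δA′)V` in the sense of (63)/(84),
   UNIQUELY (`B11Eq90Transpose.eq_of_pair27_eq`).  Proof: the four line derivatives ((85): chain rule through `pairL`; (88), (89): the product
   rule `ContinuousLinearMap.hasDerivAt_of_bilinear` + the symmetry of `Δπ`; (90)–(96): `pair27_curV0full`) and `⟨MᵗK, δ⟩ = ⟨K, Mδ⟩`.
§5 **`differentiableOn_W80`**, **`analyticOnNhd_W80`** (`ball 0 a_C`), `analyticOnNhd_W80_lt` (`{‖Y‖ < a₃}`, `a₃ ≤ a_C`) — Prop. 4's analyticity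
   clause = the `AnalyticOnNhd` hypothesis `hWa` of the owner's theorem, PROVED for this object.

HONEST SCOPE — what is NOT claimed.  (i) `J` and `Δπ` are LETTERS: `J` should be r08's `B9Eq39Adjoint.J` (the current (27)/(28) = [5] (3.11))
read in the `|·|₍₋₃₎`-carrier, `Δπ` the gauge-invariant extension Δ_π of [5] (3.118)–(3.119) (leaf-01's `B9Eq3119InvariantExtension` at the
Hilbert level) AS an operator `Space115 → NegSize … 3`; neither is instantiated here, and `Δπ`'s symmetry is a hypothesis.  (ii) THE QUADRATIC
BOUND (98) `‖W(A′)‖₍₋₃₎ ≤ C₄‖A′‖²` IS NOT PROVED HERE for `W80`: print's (86), (88)-, (89)-estimates need the kernel bounds (73) for `𝔇₃`, `𝔇`,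
(46) for `H` and [5] (3.132) for `Δ_π` — the consumer DISPLAYS `QuadAnalytic W80 C₄ a₃` (= `B11.Prop4Printed`, as the INTERFACE REQUEST allows);
the composed V₀-group's own (98)-slot is `B11Eq90V0GroupComposed.quadAnalytic_curV0full`.  (iii) The split `D = D^{(2)} + D₃` follows print
((78)–(79): the `C^{(2)}`-term belongs to Δ₁); a consumer whose 𝔊 inverts `Δ_π + DRD* + aQ*Q` WITHOUT the `J`-term of (79) must use `Emap` in
place of `E3` in W₁ (one-line variant; not typed).  (iv) `ρ`, `τ` letters; DIVERGENCE D-pv27.4 inherited.  (v) NOT summit progress (cell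
pub-balaban: NE9 NOT PRINTED / NOT PROVED; «NE9 ⇐ the named binders»; spine PROVED 0/9; HONEST DEPENDENCY: continuum YM on T⁴ ⇐ BetaPertH ∧ nine
spine estimates (0/9 proved); BetaPertH ⇐ (D1) ∧ (D4) ∧ CAP+tail; G-an2-4 gates asym, D1 and NE2/3/4).  Unit `b2b-balaban-t4-ne9-formalise-leaf-05`
(NE9 crux-team leaf prover, gen 65).  Imports `B11Eq90V0GroupComposed` ONLY; modifies nothing.
-/

noncomputable section

open NormedSpace Complex Metric Set Finset Filter Topology

namespace Literature.MathematicalPhysics.QuantumFieldTheory.Balaban1983to89.B11Eq80Current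

open Literature.MathematicalPhysics.QuantumFieldTheory.Balaban1983to89.B11Prop6Scheme (Prop4Hyp)
open Literature.MathematicalPhysics.QuantumFieldTheory.Balaban1983to89.B11Eq174Chart (solA Regime)
open Literature.MathematicalPhysics.QuantumFieldTheory.Balaban1983to89.B11Eq26ActionExpansion (V0)
open Literature.MathematicalPhysics.QuantumFieldTheory.Balaban1983to89.B11Eq90V0primeCurrent (Tsh Ucur curL curL_apply flat115
  flat115_apply)
open Literature.MathematicalPhysics.QuantumFieldTheory.Balaban1983to89.B11Eq63V0GroupCurrent (curV0)
open Literature.MathematicalPhysics.QuantumFieldTheory.Balaban1983to89.B11Eq90Transpose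
open Literature.MathematicalPhysics.QuantumFieldTheory.Balaban1983to89.B11Eq90Pullback
open Literature.MathematicalPhysics.QuantumFieldTheory.Balaban1983to89.B11Eq90V0GroupComposed
open B9SectCLatticeCarrier (Bond)
open B4Sect5Torus (TSite)
open B11Eq115Space

variable {𝔸 : Type*} [NormedRing 𝔸] [NormedAlgebra ℂ 𝔸]
variable {d : ℕ} {Pd : Fin d → ℕ} {L η : ℝ} [Fact (0 < L)] [Fact (0 < η)] {lev₀ : Bond d Pd → ℕ} {κ' : Type*} [Fintype κ']
  {lev₁ : κ' → ℕ} {Dc : (Bond d Pd → 𝔸) →ₗ[ℂ] (κ' → 𝔸)}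
variable {𝒳 : Type*} [NormedAddCommGroup 𝒳] [NormedSpace ℂ 𝒳]

/-! ## §1 `HD(A′)`, its second-order part `HD^{(2)} = HC^{(2)}` ((56), (78)) and `HD₃ = HD − HD^{(2)}` on the space (115) -/

/-- **`HD(A′) = A′ − A`** — the map `A′ ↦ HD(A′)` of (47) on the space (115): `−solA H 0 C 0 ε_C A′` (`= A′ − T47 A′`; `= H(C(A))` under the
Sect. C regime, (48)/(49)). [cite: Balaban1985Variational, (47)–(49) p.285] -/
def Emap (H : 𝒳 →L[ℂ] Space115 L η lev₀ lev₁ Dc) (C : Space115 L η lev₀ lev₁ Dc → 𝒳) (εC : ℝ)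
    (A' : Space115 L η lev₀ lev₁ Dc) : Space115 L η lev₀ lev₁ Dc :=
  -solA H 0 C 0 εC A'

/-- **THE SECOND-ORDER PART OF AN ANALYTIC MAP AT `0`**: `F^{(2)}(Y) := ½·D²F(0)(Y, Y)` — print's `C^{(2)}(A′)`/`D^{(2)}(A′)` of (56), (78) («the
second order term D^{(2)}(A′) in the expansion of D(A′) is equal to C^{(2)}(A′)»), typed canonically through `iteratedFDeriv`.
[cite: Balaban1985Variational, (56) p.286, (78) p.290] -/
def quadPart (F : Space115 L η lev₀ lev₁ Dc → 𝒳) (Y : Space115 L η lev₀ lev₁ Dc) : 𝒳 :=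
  (2 : ℂ)⁻¹ • iteratedFDeriv ℂ 2 F 0 (fun _ => Y)

/-- **`HD₃(A′) = HD(A′) − HC^{(2)}(A′)`** — the part of `HD(A′)` of order `≥ 3` ((78): «⟨HD(A′), J⟩ = ⟨HC^{(2)}(A′), J⟩ + ⟨HD₃(A′), J⟩», the
`C^{(2)}`-term being absorbed into the quadratic form Δ₁ of (79)). [cite: Balaban1985Variational, (78) p.290, (79)–(80) p.290] -/
def E3 (H : 𝒳 →L[ℂ] Space115 L η lev₀ lev₁ Dc) (C : Space115 L η lev₀ lev₁ Dc → 𝒳) (εC : ℝ)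
    (A' : Space115 L η lev₀ lev₁ Dc) : Space115 L η lev₀ lev₁ Dc :=
  Emap H C εC A' - H (quadPart C A')

variable {H : 𝒳 →L[ℂ] Space115 L η lev₀ lev₁ Dc} {C : Space115 L η lev₀ lev₁ Dc → 𝒳} {b C₂ c₄ aC εC : ℝ}

/-- `HD(A′) = A′ − A`. [cite: Balaban1985Variational, (47) p.285] -/
theorem Emap_eq_sub (εC : ℝ) (A' : Space115 L η lev₀ lev₁ Dc) : Emap H C εC A' = A' - T47 H C εC A' := by
  rw [Emap, T47_apply]; abel

/-- `Emap` as a function: `id − T47`. [cite: Balaban1985Variational, (47) p.285] -/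
theorem Emap_eq (εC : ℝ) : Emap H C εC = fun A' : Space115 L η lev₀ lev₁ Dc => A' - T47 H C εC A' :=
  funext (Emap_eq_sub εC)

section RegimeC

variable [FiniteDimensional ℂ 𝔸]

/-- Under the Sect. C regime: `HD(A′) = H(C(A))`, `A = T47 A′` ((48)/(49)). [cite: Balaban1985Variational, (48)–(49) p.285] -/
theorem Emap_eq_H (RC : Regime H 0 C b 0 C₂ c₄ 0 aC εC) {A' : Space115 L η lev₀ lev₁ Dc} (hA' : ‖A'‖ < aC) :
    Emap H C εC A' = H (C (T47 H C εC A')) := by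
  rw [Emap_eq_sub, ← neg_neg (H _), ← T47_sub_self RC hA']; abel

/-- `HD` is analytic on `‖A′‖ < a_C`. [cite: Balaban1985Variational, p.286, Prop. 3 p.289] -/
theorem analyticOnNhd_Emap (RC : Regime H 0 C b 0 C₂ c₄ 0 aC εC) (hC : Prop4Hyp C C₂ c₄) :
    AnalyticOnNhd ℂ (Emap H C εC) (ball (0 : Space115 L η lev₀ lev₁ Dc) aC) := by
  rw [Emap_eq]
  exact analyticOnNhd_id.sub (analyticOnNhd_T47 RC hC)

omit [FiniteDimensional ℂ 𝔸] in
/-- The second-order part is `C^∞` (a continuous bilinear form on the diagonal). [cite: Balaban1985Variational, (56) p.286] -/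
theorem contDiff_quadPart (F : Space115 L η lev₀ lev₁ Dc → 𝒳) {n : WithTop ℕ∞} :
    ContDiff ℂ n (quadPart F) := by
  unfold quadPart
  exact contDiff_const.smul ((ContinuousMultilinearMap.contDiff _).comp (contDiff_pi.2 fun _ => contDiff_id))

/-- The second-order part is analytic everywhere (finite-dimensional carrier). [cite: Balaban1985Variational, (56) p.286] -/
theorem analyticOnNhd_quadPart (F : Space115 L η lev₀ lev₁ Dc → 𝒳) (s : Set (Space115 L η lev₀ lev₁ Dc)) [CompleteSpace 𝒳] :
    AnalyticOnNhd ℂ (quadPart F) s :=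
  (Literature.Analysis.Complex.SCV.analyticOnNhd_of_differentiableOn
    (((contDiff_quadPart F (n := 1)).differentiable one_ne_zero).differentiableOn) isOpen_univ).mono (subset_univ _)

/-- `HD₃` is analytic on `‖A′‖ < a_C`. [cite: Balaban1985Variational, p.289 (after Prop. 3)] -/
theorem analyticOnNhd_E3 [CompleteSpace 𝒳] (RC : Regime H 0 C b 0 C₂ c₄ 0 aC εC) (hC : Prop4Hyp C C₂ c₄) :
    AnalyticOnNhd ℂ (E3 H C εC) (ball (0 : Space115 L η lev₀ lev₁ Dc) aC) :=
  (analyticOnNhd_Emap RC hC).sub (H.analyticOnNhd _ |>.comp (analyticOnNhd_quadPart C _) (mapsTo_univ _ _))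

end RegimeC

/-! ## §2 The pairing as a continuous bilinear map (for the product rule along a line) -/

section PairL

variable [FiniteDimensional ℂ 𝔸]

/-- The pairing (27) `(K, Y) ↦ ⟨K, Y⟩` of a current with a configuration of the space (115), as a continuous bilinear map (finite dimension).
[cite: Balaban1985Variational, (27) p.282] -/
def pairL (τ : 𝔸 →L[ℂ] ℂ) : NegSize L η lev₀ 3 𝔸 →L[ℂ] Space115 L η lev₀ lev₁ Dc →L[ℂ] ℂ :=
  LinearMap.toContinuousLinearMap
    { toFun := fun K => LinearMap.toContinuousLinearMap
        { toFun := fun Y => pair27 τ K (flat115 Y)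
          map_add' := fun Y Z => by rw [map_add, pair27_add_right]
          map_smul' := fun c Y => by rw [map_smul, pair27_smul_right, RingHom.id_apply, smul_eq_mul] }
      map_add' := fun K₁ K₂ => by ext Y; exact pair27_add_left τ K₁ K₂ _
      map_smul' := fun c K => by ext Y; exact pair27_smul_left τ c K _ }

/-- Unfolding: `pairL τ K Y = ⟨K, Y⟩`. [cite: Balaban1985Variational, (27) p.282] -/
@[simp] theorem pairL_apply (τ : 𝔸 →L[ℂ] ℂ) (K : NegSize L η lev₀ 3 𝔸) (Y : Space115 L η lev₀ lev₁ Dc) :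
    pairL τ K Y = pair27 τ K (flat115 Y) := rfl

end PairL

/-! ## §3 `V(A′)` of (80) and `W(A′) = (δ/δA′)V(A′)` of (84)–(90) as ONE object, modulo the letters `J` and `Δ_π` at the carrier -/

section Current

variable [FiniteDimensional ℂ 𝔸] [CompleteSpace 𝔸]

/-- **`V(A′)` OF (80)**: `V(A′) = −⟨HD₃(A′), J⟩ − ⟨A′, Δ_π HD(A′)⟩ + ½⟨HD(A′), Δ_π HD(A′)⟩ + V₀(A′ − HD(A′))`, with the LETTERS `J : NegSize … 3 𝔸`
(the current (27)/(28) of the background, read in the `|·|₍₋₃₎`-carrier) and `Δπ : Space115 … →L[ℂ] NegSize … 3 𝔸` (the gauge-invariant extension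
Δ_π of [5] (3.119) as an operator from configurations to currents), `V₀` r08's `B11Eq26ActionExpansion.V0` of (26) under the torus bridge, `HD`,
`HD₃` of §1. [cite: Balaban1985Variational, (80) p.290] -/
def V80 (τ : 𝔸 →L[ℂ] ℂ) (U₀ : Bond d Pd → 𝔸ˣ) (H : 𝒳 →L[ℂ] Space115 L η lev₀ lev₁ Dc) (C : Space115 L η lev₀ lev₁ Dc → 𝒳) (εC : ℝ)
    (J : NegSize L η lev₀ 3 𝔸) (Δπ : Space115 L η lev₀ lev₁ Dc →L[ℂ] NegSize L η lev₀ 3 𝔸) (A' : Space115 L η lev₀ lev₁ Dc) : ℂ :=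
  -pair27 τ J (flat115 (E3 H C εC A')) - pair27 τ (Δπ (Emap H C εC A')) (flat115 A')
    + 2⁻¹ * pair27 τ (Δπ (Emap H C εC A')) (flat115 (Emap H C εC A'))
    + V0 Tsh (Ucur U₀) η d (τ : 𝔸 →ₗ[ℂ] ℂ) (curL (flat115 (T47 H C εC A')))

/-- **(85): `W₁(A′) = −𝔇₃*(A′)H*J`** — the derivative of `−⟨HD₃(A′), J⟩`: `−((HD₃)′(A′))ᵗ J`. [cite: Balaban1985Variational, (85) p.291] -/
def W1 (ρ : (𝔸 →L[ℂ] ℂ) →L[ℂ] 𝔸) (τ : 𝔸 →L[ℂ] ℂ) (H : 𝒳 →L[ℂ] Space115 L η lev₀ lev₁ Dc) (C : Space115 L η lev₀ lev₁ Dc → 𝒳) (εC : ℝ)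
    (J : NegSize L η lev₀ 3 𝔸) (A' : Space115 L η lev₀ lev₁ Dc) : NegSize L η lev₀ 3 𝔸 :=
  -transCur ρ τ (fderiv ℂ (E3 H C εC) A') J

/-- **(87)–(88): `W₂(A′) = −(Δ_π HD(A′) + 𝔇*(A′)H*Δ_π A′)`** — the derivative of `−⟨A′, Δ_π HD(A′)⟩` (Δ_π symmetric).
[cite: Balaban1985Variational, (87)–(88) p.291] -/
def W2 (ρ : (𝔸 →L[ℂ] ℂ) →L[ℂ] 𝔸) (τ : 𝔸 →L[ℂ] ℂ) (H : 𝒳 →L[ℂ] Space115 L η lev₀ lev₁ Dc) (C : Space115 L η lev₀ lev₁ Dc → 𝒳) (εC : ℝ)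
    (Δπ : Space115 L η lev₀ lev₁ Dc →L[ℂ] NegSize L η lev₀ 3 𝔸) (A' : Space115 L η lev₀ lev₁ Dc) : NegSize L η lev₀ 3 𝔸 :=
  -(Δπ (Emap H C εC A') + transCur ρ τ (fderiv ℂ (Emap H C εC) A') (Δπ A'))

/-- **(89): `W₃(A′) = 𝔇*(A′)H*Δ_π HD(A′)`** — the derivative of `½⟨HD(A′), Δ_π HD(A′)⟩` (Δ_π symmetric). [cite: Balaban1985Variational, (89) p.291] -/
def W3 (ρ : (𝔸 →L[ℂ] ℂ) →L[ℂ] 𝔸) (τ : 𝔸 →L[ℂ] ℂ) (H : 𝒳 →L[ℂ] Space115 L η lev₀ lev₁ Dc) (C : Space115 L η lev₀ lev₁ Dc → 𝒳) (εC : ℝ)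
    (Δπ : Space115 L η lev₀ lev₁ Dc →L[ℂ] NegSize L η lev₀ 3 𝔸) (A' : Space115 L η lev₀ lev₁ Dc) : NegSize L η lev₀ 3 𝔸 :=
  transCur ρ τ (fderiv ℂ (Emap H C εC) A') (Δπ (Emap H C εC A'))

/-- **`W(A′) = ((δ/δA′)V)(A′)` OF (84)–(96) AS ONE OBJECT** on the carriers of (115): `W = W₁ + W₂ + W₃ + curV0full` — (85) + (88) + (89) + the
V₀-group (90)–(96) composed with (47) (`B11Eq90V0GroupComposed.curV0full`).  A map `Space115 L η lev₀ lev₁ Dc → NegSize L η lev₀ 3 𝔸` = the W-slot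
type of the owner's `NE9CurChartOfBackground.cur_chart_exists_of_W_H126`, modulo the letters `J`, `Δπ` (and `ρ`, `τ`, `U₀`, `H`, `C`, `ε_C`).
[cite: Balaban1985Variational, (84) p.290, (85)–(96) pp.291–292] -/
def W80 (ρ : (𝔸 →L[ℂ] ℂ) →L[ℂ] 𝔸) (τ : 𝔸 →L[ℂ] ℂ) (U₀ : Bond d Pd → 𝔸ˣ) (H : 𝒳 →L[ℂ] Space115 L η lev₀ lev₁ Dc)
    (C : Space115 L η lev₀ lev₁ Dc → 𝒳) (εC : ℝ) (J : NegSize L η lev₀ 3 𝔸) (Δπ : Space115 L η lev₀ lev₁ Dc →L[ℂ] NegSize L η lev₀ 3 𝔸)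
    (A' : Space115 L η lev₀ lev₁ Dc) : NegSize L η lev₀ 3 𝔸 :=
  W1 ρ τ H C εC J A' + W2 ρ τ H C εC Δπ A' + W3 ρ τ H C εC Δπ A' + curV0full ρ τ U₀ H C εC A'

/-! ## §4 The (63) certificate: `⟨W(A′), δ⟩ = (d/dt)V(A′ + tδ)|_{t=0}` -/

variable {ρ : (𝔸 →L[ℂ] ℂ) →L[ℂ] 𝔸} {τ : 𝔸 →L[ℂ] ℂ}

omit [FiniteDimensional ℂ 𝔸] [CompleteSpace 𝔸] in
/-- The line `t ↦ A′ + tδ` has derivative `δ`. [cite: Balaban1985Variational, (63) p.287] -/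
theorem hasDerivAt_line (A' δ' : Space115 L η lev₀ lev₁ Dc) : HasDerivAt (fun t : ℂ => A' + t • δ') δ' 0 := by
  simpa using ((hasDerivAt_id (0 : ℂ)).smul_const δ').const_add A'

omit [FiniteDimensional ℂ 𝔸] [CompleteSpace 𝔸] in
/-- The derivative of a differentiable map along the line: `(d/dt)G(A′ + tδ)|₀ = G′(A′)δ` as a `HasDerivAt` statement.
[cite: Balaban1985Variational, (63) p.287] -/
theorem hasDerivAt_comp_line {E : Type*} [NormedAddCommGroup E] [NormedSpace ℂ E] {G : Space115 L η lev₀ lev₁ Dc → E}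
    {A' : Space115 L η lev₀ lev₁ Dc} (hG : DifferentiableAt ℂ G A') (δ' : Space115 L η lev₀ lev₁ Dc) :
    HasDerivAt (fun t : ℂ => G (A' + t • δ')) (fderiv ℂ G A' δ') 0 := by
  have h : HasFDerivAt G (fderiv ℂ G A') (A' + (0 : ℂ) • δ') := by simpa using hG.hasFDerivAt
  exact h.comp_hasDerivAt (0 : ℂ) (hasDerivAt_line A' δ')

/-- **THE (63) CERTIFICATE FOR `W = (δ/δA′)V`**: on `‖A′‖ < a_C` (Sect. C regime, `C` of Prop.-4 type), for a tracial `τ`, the dualising identity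
`τ(ρ(ℓ)X) = ℓ X`, `d ≥ 4` and a `Δπ` SYMMETRIC for the pairing (`⟨Δπ Y, Z⟩ = ⟨Δπ Z, Y⟩`, [5] (3.119) is a quadratic form):
`⟨W(A′), δ⟩ = (d/dt) V(A′ + tδ)|_{t=0}` — `W80` IS the functional derivative of `V80` in print's sense (84), UNIQUELY by
`B11Eq90Transpose.eq_of_pair27_eq`. [cite: Balaban1985Variational, (63) p.287, (84) p.290, (85)–(90) p.291] -/
theorem pair27_W80 (hρ : ∀ (ℓ : 𝔸 →L[ℂ] ℂ) (X : 𝔸), τ (ρ ℓ * X) = ℓ X) (hτ : ∀ a b : 𝔸, τ (a * b) = τ (b * a)) (hd : 4 ≤ d)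
    (U₀ : Bond d Pd → 𝔸ˣ) (RC : Regime H 0 C b 0 C₂ c₄ 0 aC εC) (hC : Prop4Hyp C C₂ c₄) [CompleteSpace 𝒳] (J : NegSize L η lev₀ 3 𝔸)
    {Δπ : Space115 L η lev₀ lev₁ Dc →L[ℂ] NegSize L η lev₀ 3 𝔸}
    (hΔ : ∀ Y Z : Space115 L η lev₀ lev₁ Dc, pair27 τ (Δπ Y) (flat115 Z) = pair27 τ (Δπ Z) (flat115 Y))
    {A' : Space115 L η lev₀ lev₁ Dc} (hA' : ‖A'‖ < aC) (δ' : Space115 L η lev₀ lev₁ Dc) :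
    pair27 τ (W80 ρ τ U₀ H C εC J Δπ A') (flat115 δ') = deriv (fun t : ℂ => V80 τ U₀ H C εC J Δπ (A' + t • δ')) 0 := by
  have hmem : A' ∈ ball (0 : Space115 L η lev₀ lev₁ Dc) aC := mem_ball_zero_iff.2 hA'
  have hnhds : ball (0 : Space115 L η lev₀ lev₁ Dc) aC ∈ 𝓝 A' := isOpen_ball.mem_nhds hmem
  -- differentiability of the pieces at `A′`
  have hE : DifferentiableAt ℂ (Emap H C εC) A' := ((analyticOnNhd_Emap RC hC).differentiableOn.differentiableAt hnhds)
  have hE3 : DifferentiableAt ℂ (E3 H C εC) A' := ((analyticOnNhd_E3 RC hC).differentiableOn.differentiableAt hnhds)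
  -- the four line derivatives
  have h1 : HasDerivAt (fun t : ℂ => -pair27 τ J (flat115 (E3 H C εC (A' + t • δ'))))
      (-pair27 τ J (flat115 (fderiv ℂ (E3 H C εC) A' δ'))) 0 := by
    have h := ((pairL (lev₁ := lev₁) (Dc := Dc) τ J).hasFDerivAt.comp_hasDerivAt (0 : ℂ) (hasDerivAt_comp_line hE3 δ')).neg
    simpa only [Function.comp_def, pairL_apply, Pi.neg_def] using h
  have h2 : HasDerivAt (fun t : ℂ => -pair27 τ (Δπ (Emap H C εC (A' + t • δ'))) (flat115 (A' + t • δ')))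
      (-(pair27 τ (Δπ (Emap H C εC A')) (flat115 δ') + pair27 τ (Δπ (fderiv ℂ (Emap H C εC) A' δ')) (flat115 A'))) 0 := by
    have hu : HasDerivAt (fun t : ℂ => Δπ (Emap H C εC (A' + t • δ'))) (Δπ (fderiv ℂ (Emap H C εC) A' δ')) 0 :=
      (Δπ.hasFDerivAt.comp_hasDerivAt (0 : ℂ) (hasDerivAt_comp_line hE δ'))
    have h := (ContinuousLinearMap.hasDerivAt_of_bilinear (B := pairL (lev₁ := lev₁) (Dc := Dc) τ)
      (fun _ => hu) (fun _ => hasDerivAt_line A' δ')).neg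
    simpa only [pairL_apply, zero_smul, add_zero, Pi.neg_def] using h
  have h3 : HasDerivAt (fun t : ℂ => 2⁻¹ * pair27 τ (Δπ (Emap H C εC (A' + t • δ'))) (flat115 (Emap H C εC (A' + t • δ'))))
      (2⁻¹ * (pair27 τ (Δπ (Emap H C εC A')) (flat115 (fderiv ℂ (Emap H C εC) A' δ'))
        + pair27 τ (Δπ (fderiv ℂ (Emap H C εC) A' δ')) (flat115 (Emap H C εC A')))) 0 := by
    have hu : HasDerivAt (fun t : ℂ => Δπ (Emap H C εC (A' + t • δ'))) (Δπ (fderiv ℂ (Emap H C εC) A' δ')) 0 :=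
      (Δπ.hasFDerivAt.comp_hasDerivAt (0 : ℂ) (hasDerivAt_comp_line hE δ'))
    have hv : HasDerivAt (fun t : ℂ => Emap H C εC (A' + t • δ')) (fderiv ℂ (Emap H C εC) A' δ') 0 := hasDerivAt_comp_line hE δ'
    have h := (ContinuousLinearMap.hasDerivAt_of_bilinear (B := pairL (lev₁ := lev₁) (Dc := Dc) τ) (fun _ => hu) (fun _ => hv)).const_mul
      (2⁻¹ : ℂ)
    simpa only [pairL_apply, zero_smul, add_zero] using h
  have h4 : HasDerivAt (fun t : ℂ => V0 Tsh (Ucur U₀) η d (τ : 𝔸 →ₗ[ℂ] ℂ) (curL (flat115 (T47 H C εC (A' + t • δ')))))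
      (pair27 τ (curV0full ρ τ U₀ H C εC A') (flat115 δ')) 0 := by
    have hT : DifferentiableAt ℂ (T47 H C εC) A' := (differentiableOn_T47 RC hC).differentiableAt hnhds
    have hF : Differentiable ℂ (fun Y : Space115 L η lev₀ lev₁ Dc => V0 Tsh (Ucur U₀) η d (τ : 𝔸 →ₗ[ℂ] ℂ) (curL (flat115 Y))) :=
      (differentiable_V0 τ hτ hd U₀).comp
        (((curL : (Bond d Pd → 𝔸) →L[ℂ] (Fin d → TSite d Pd → 𝔸)).comp
          (flat115 (L := L) (η := η) (lev₀ := lev₀) (lev₁ := lev₁) (Dc := Dc))).differentiable)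
    have hdd := hasDerivAt_comp_line ((hF _).comp A' hT) δ'
    rw [pair27_curV0full ρ τ hρ hτ hd U₀ RC hC hA' (flat115 δ')]
    exact hdd.differentiableAt.hasDerivAt
  -- assemble
  have hsum := ((h1.fun_add h2).fun_add h3).fun_add h4
  have e : (fun t : ℂ => V80 τ U₀ H C εC J Δπ (A' + t • δ'))
      = fun t : ℂ => -pair27 τ J (flat115 (E3 H C εC (A' + t • δ')))
          + -pair27 τ (Δπ (Emap H C εC (A' + t • δ'))) (flat115 (A' + t • δ'))
          + 2⁻¹ * pair27 τ (Δπ (Emap H C εC (A' + t • δ'))) (flat115 (Emap H C εC (A' + t • δ')))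
          + V0 Tsh (Ucur U₀) η d (τ : 𝔸 →ₗ[ℂ] ℂ) (curL (flat115 (T47 H C εC (A' + t • δ')))) := by
    funext t; simp only [V80]; ring
  rw [e, hsum.deriv]
  -- identify the four currents: `⟨MᵗK, δ⟩ = ⟨K, Mδ⟩` and the symmetry of `Δ_π`
  simp only [W80, W1, W2, W3, pair27_add_left, pair27_neg_left, pair27_transCur' ρ τ hρ]
  rw [hΔ (fderiv ℂ (Emap H C εC) A' δ') A', hΔ (fderiv ℂ (Emap H C εC) A' δ') (Emap H C εC A')]
  ring

/-! ## §5 `W` is differentiable — indeed analytic — on the ball `‖A′‖ < a_C` -/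

/-- **`W = (δ/δA′)V` IS DIFFERENTIABLE ON `‖A′‖ < a_C`** (Prop. 4: «The functional derivative of V(A′) is an analytic function on this space»):
each group is a transposed differentiable family (`B11Eq90Pullback.differentiableOn_transCur_apply`) or the composed V₀-group.
[cite: Balaban1985Variational, Prop. 4 p.292] -/
theorem differentiableOn_W80 (ρ : (𝔸 →L[ℂ] ℂ) →L[ℂ] 𝔸) (τ : 𝔸 →L[ℂ] ℂ) (U₀ : Bond d Pd → 𝔸ˣ) (RC : Regime H 0 C b 0 C₂ c₄ 0 aC εC)
    (hC : Prop4Hyp C C₂ c₄) [CompleteSpace 𝒳] (J : NegSize L η lev₀ 3 𝔸) (Δπ : Space115 L η lev₀ lev₁ Dc →L[ℂ] NegSize L η lev₀ 3 𝔸) :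
    DifferentiableOn ℂ (W80 ρ τ U₀ H C εC J Δπ) (ball (0 : Space115 L η lev₀ lev₁ Dc) aC) := by
  have hE := analyticOnNhd_Emap RC hC (L := L) (η := η) (lev₀ := lev₀) (lev₁ := lev₁) (Dc := Dc)
  have hE' : DifferentiableOn ℂ (fun A' => fderiv ℂ (Emap H C εC) A') (ball (0 : Space115 L η lev₀ lev₁ Dc) aC) :=
    hE.fderiv.differentiableOn
  have hE3' : DifferentiableOn ℂ (fun A' => fderiv ℂ (E3 H C εC) A') (ball (0 : Space115 L η lev₀ lev₁ Dc) aC) :=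
    (analyticOnNhd_E3 RC hC).fderiv.differentiableOn
  have h1 : DifferentiableOn ℂ (W1 ρ τ H C εC J) (ball (0 : Space115 L η lev₀ lev₁ Dc) aC) :=
    (differentiableOn_transCur_apply ρ τ hE3' (differentiableOn_const J)).neg
  have h2 : DifferentiableOn ℂ (W2 ρ τ H C εC Δπ) (ball (0 : Space115 L η lev₀ lev₁ Dc) aC) :=
    ((Δπ.differentiable.comp_differentiableOn hE.differentiableOn).add
      (differentiableOn_transCur_apply ρ τ hE' Δπ.differentiable.differentiableOn)).neg
  have h3 : DifferentiableOn ℂ (W3 ρ τ H C εC Δπ) (ball (0 : Space115 L η lev₀ lev₁ Dc) aC) :=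
    differentiableOn_transCur_apply ρ τ hE' (Δπ.differentiable.comp_differentiableOn hE.differentiableOn)
  exact ((h1.add h2).add h3).add (differentiableOn_curV0full ρ τ U₀ RC hC)

/-- **… AND ANALYTIC THERE** (finite-dimensional carrier, Osgood) — the `AnalyticOnNhd` clause of the owner's W-slot on the ball `‖A′‖ < a_C`.
[cite: Balaban1985Variational, Prop. 4 p.292] -/
theorem analyticOnNhd_W80 (ρ : (𝔸 →L[ℂ] ℂ) →L[ℂ] 𝔸) (τ : 𝔸 →L[ℂ] ℂ) (U₀ : Bond d Pd → 𝔸ˣ) (RC : Regime H 0 C b 0 C₂ c₄ 0 aC εC)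
    (hC : Prop4Hyp C C₂ c₄) [CompleteSpace 𝒳] (J : NegSize L η lev₀ 3 𝔸) (Δπ : Space115 L η lev₀ lev₁ Dc →L[ℂ] NegSize L η lev₀ 3 𝔸) :
    AnalyticOnNhd ℂ (W80 ρ τ U₀ H C εC J Δπ) (ball (0 : Space115 L η lev₀ lev₁ Dc) aC) :=
  Literature.Analysis.Complex.SCV.analyticOnNhd_of_differentiableOn (differentiableOn_W80 ρ τ U₀ RC hC J Δπ) isOpen_ball

/-- The same on the W-slot's set `{Y | ‖Y‖ < a₃}` for any `a₃ ≤ a_C`. [cite: Balaban1985Variational, Prop. 4 p.292] -/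
theorem analyticOnNhd_W80_lt (ρ : (𝔸 →L[ℂ] ℂ) →L[ℂ] 𝔸) (τ : 𝔸 →L[ℂ] ℂ) (U₀ : Bond d Pd → 𝔸ˣ) (RC : Regime H 0 C b 0 C₂ c₄ 0 aC εC)
    (hC : Prop4Hyp C C₂ c₄) [CompleteSpace 𝒳] (J : NegSize L η lev₀ 3 𝔸) (Δπ : Space115 L η lev₀ lev₁ Dc →L[ℂ] NegSize L η lev₀ 3 𝔸)
    {a₃ : ℝ} (ha₃ : a₃ ≤ aC) :
    AnalyticOnNhd ℂ (W80 ρ τ U₀ H C εC J Δπ) {Y : Space115 L η lev₀ lev₁ Dc | ‖Y‖ < a₃} :=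
  (analyticOnNhd_W80 ρ τ U₀ RC hC J Δπ).mono fun _ hY => mem_ball_zero_iff.2 (lt_of_lt_of_le hY ha₃)

end Current

end Literature.MathematicalPhysics.QuantumFieldTheory.Balaban1983to89.B11Eq80Current

end
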